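import Summits.Ventures.PercRepro.C025ProfileHallParallel
import Summits.Ventures.PercRepro.C025ProfileLoop

/-!
# C-033 «SHADOW HALL (H⁺)» — the loop step for every family, every `(q, u)` (night-3 g7)

`hallIneq_of_delete_isLoop`: for a loop `ℓ` of a finite matroid `M`, `(H⁺_{q,u})` on `M ＼ {ℓ}` gives `(H⁺_{q,u})` on
`M`. A family `𝒜` of rank-`q` sets of `M` splits into the members avoiding `ℓ` (rank-`q` sets of `M ＼ ℓ`, same prices:
`price_delete_of_isLoop_notMem`) and the members containing `ℓ`, which erased are rank-`q` sets of `M ＼ ℓ` with the same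
prices (`price_delete_of_isLoop_mem`); the `M ＼ ℓ`-shadow of the first family lies in the `ℓ`-free part of the `M`-shadow
and `insert ℓ` sends the `M ＼ ℓ`-shadow of the second into the `ℓ`-part (`card_shadowLevel_ge_of_isLoop`).
The level-set facts `eRk_insert_of_isLoop` / `eRk_delete_of_notMem` are those of `C025ProfileLoop`.
-/

open scoped Matroid

namespace PercRepro

open Set Finset ThmH

section HallLoop

variable {α : Type} [DecidableEq α] {M : Matroid α} [M.Finite]

/-- A rank-`q` set of `M` avoiding the loop `ℓ` is a rank-`q` set of `M ＼ {ℓ}`. -/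
theorem mem_Rq_delete_of_isLoop_notMem {q : ℕ} {ℓ : α} {B : Finset α} (hB : B ∈ Profile.Rq M q) (hℓB : ℓ ∉ B) :
    B ∈ Profile.Rq (M ＼ ({ℓ} : Set α)) q := by
  rw [Profile.mem_Rq] at hB ⊢
  rw [gr_delete_singleton'']
  refine ⟨fun x hx => Finset.mem_erase.2 ⟨fun h => hℓB (h ▸ hx), hB.1 hx⟩, ?_⟩
  rw [eRk_delete_of_notMem hB.1 hℓB]
  exact hB.2

/-- A rank-`q` set of `M` containing the loop `ℓ`, with `ℓ` erased, is a rank-`q` set of `M ＼ {ℓ}`. -/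
theorem erase_mem_Rq_delete_of_isLoop_mem {q : ℕ} {ℓ : α} (hℓ : M.IsLoop ℓ) {B : Finset α}
    (hB : B ∈ Profile.Rq M q) (hℓB : ℓ ∈ B) : B.erase ℓ ∈ Profile.Rq (M ＼ ({ℓ} : Set α)) q := by
  rw [Profile.mem_Rq] at hB ⊢
  rw [gr_delete_singleton'']
  refine ⟨fun x hx => ?_, ?_⟩
  · rw [Finset.mem_erase] at hx ⊢; exact ⟨hx.1, hB.1 hx.2⟩
  · have hsub : B.erase ℓ ⊆ gr M := (Finset.erase_subset _ _).trans hB.1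
    have hne : ℓ ∉ B.erase ℓ := Finset.notMem_erase ℓ B
    rw [eRk_delete_of_notMem hsub hne]
    have h1 : B = insert ℓ (B.erase ℓ) := (Finset.insert_erase hℓB).symm
    have hr := hB.2
    rw [h1, Finset.coe_insert, eRk_insert_of_isLoop hℓ] at hr
    exact hr

/-- The `M ＼ {ℓ}`-shadow of the members avoiding `ℓ` lies in the `ℓ`-free part of the `M`-shadow. -/
theorem shadow_delete_subset_of_isLoop {ℓ : α} (u : ℕ) (𝒜 : Finset (Finset α)) :
    Shadow.shadowLevel (M ＼ ({ℓ} : Set α)) u (𝒜.filter (fun B => ℓ ∉ B)) ⊆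
      (Shadow.shadowLevel M u 𝒜).filter (fun S => ℓ ∉ S) := by
  intro S hS
  rw [mem_shadowLevel] at hS
  obtain ⟨hSlev, B, hB, hBS⟩ := hS
  rw [Profile.mem_levelSet, gr_delete_singleton''] at hSlev
  have hℓS : ℓ ∉ S := fun h => (Finset.mem_erase.1 (hSlev.1 h)).1 rfl
  have hSg : S ⊆ gr M := hSlev.1.trans (Finset.erase_subset _ _)
  rw [Finset.mem_filter, mem_shadowLevel, Profile.mem_levelSet]
  refine ⟨⟨⟨hSg, ?_⟩, B, (Finset.mem_filter.1 hB).1, hBS⟩, hℓS⟩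
  rw [← eRk_delete_of_notMem hSg hℓS]
  exact hSlev.2

/-- `insert ℓ` sends the `M ＼ {ℓ}`-shadow of the erased members containing `ℓ` injectively into the `ℓ`-part of the
`M`-shadow. -/
theorem card_shadow_erase_le_of_isLoop {ℓ : α} (hℓ : M.IsLoop ℓ) (u : ℕ) (𝒜 : Finset (Finset α)) :
    (Shadow.shadowLevel (M ＼ ({ℓ} : Set α)) u ((𝒜.filter (fun B => ℓ ∈ B)).image (fun B => B.erase ℓ))).card ≤
      ((Shadow.shadowLevel M u 𝒜).filter (fun S => ℓ ∈ S)).card := by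
  have hℓE : ℓ ∈ gr M := by rw [← Finset.mem_coe, coe_gr]; exact hℓ.mem_ground
  apply Finset.card_le_card_of_injOn (fun S' => insert ℓ S')
  · intro S' hS'
    rw [Finset.mem_coe, mem_shadowLevel] at hS'
    obtain ⟨hS'lev, B', hB', hB'S'⟩ := hS'
    rw [Finset.mem_image] at hB'
    obtain ⟨B, hB, rfl⟩ := hB'
    rw [Finset.mem_filter] at hB
    rw [Profile.mem_levelSet, gr_delete_singleton''] at hS'lev
    have hℓS' : ℓ ∉ S' := fun h => (Finset.mem_erase.1 (hS'lev.1 h)).1 rfl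
    have hS'g : S' ⊆ gr M := hS'lev.1.trans (Finset.erase_subset _ _)
    rw [Finset.mem_coe, Finset.mem_filter, mem_shadowLevel, Profile.mem_levelSet]
    refine ⟨⟨⟨Finset.insert_subset hℓE hS'g, ?_⟩, B, hB.1, ?_⟩, Finset.mem_insert_self _ _⟩
    · rw [Finset.coe_insert, eRk_insert_of_isLoop hℓ, ← eRk_delete_of_notMem hS'g hℓS']
      exact hS'lev.2
    · intro x hx
      by_cases hxℓ : x = ℓ
      · rw [hxℓ]; exact Finset.mem_insert_self _ _
      · exact Finset.mem_insert_of_mem (hB'S' (Finset.mem_erase.2 ⟨hxℓ, hx⟩))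
  · intro S₁ hS₁ S₂ hS₂ h
    simp only at h
    rw [Finset.mem_coe, mem_shadowLevel] at hS₁ hS₂
    have h₁ : ℓ ∉ S₁ := by
      intro hℓS
      have := hS₁.1
      rw [Profile.mem_levelSet, gr_delete_singleton''] at this
      exact (Finset.mem_erase.1 (this.1 hℓS)).1 rfl
    have h₂ : ℓ ∉ S₂ := by
      intro hℓS
      have := hS₂.1
      rw [Profile.mem_levelSet, gr_delete_singleton''] at this
      exact (Finset.mem_erase.1 (this.1 hℓS)).1 rfl
    rw [← Finset.erase_insert h₁, ← Finset.erase_insert h₂, h]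

/-- **The shadow split at a loop `ℓ`**: `#∂^{M＼ℓ}_u 𝒜₀ + #∂^{M＼ℓ}_u 𝒜₁ ≤ #∂^M_u 𝒜` (`𝒜₀` = the members avoiding `ℓ`,
`𝒜₁` = the members containing `ℓ`, erased). -/
theorem card_shadowLevel_ge_of_isLoop {ℓ : α} (hℓ : M.IsLoop ℓ) (u : ℕ) (𝒜 : Finset (Finset α)) :
    (Shadow.shadowLevel (M ＼ ({ℓ} : Set α)) u (𝒜.filter (fun B => ℓ ∉ B))).card +
      (Shadow.shadowLevel (M ＼ ({ℓ} : Set α)) u ((𝒜.filter (fun B => ℓ ∈ B)).image (fun B => B.erase ℓ))).card ≤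
      (Shadow.shadowLevel M u 𝒜).card := by
  calc (Shadow.shadowLevel (M ＼ ({ℓ} : Set α)) u (𝒜.filter (fun B => ℓ ∉ B))).card +
        (Shadow.shadowLevel (M ＼ ({ℓ} : Set α)) u ((𝒜.filter (fun B => ℓ ∈ B)).image (fun B => B.erase ℓ))).card
      ≤ ((Shadow.shadowLevel M u 𝒜).filter (fun S => ℓ ∉ S)).card +
        ((Shadow.shadowLevel M u 𝒜).filter (fun S => ℓ ∈ S)).card :=
        Nat.add_le_add (Finset.card_le_card (shadow_delete_subset_of_isLoop u 𝒜)) (card_shadow_erase_le_of_isLoop hℓ u 𝒜)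
    _ = (Shadow.shadowLevel M u 𝒜).card := by
        rw [add_comm, Finset.card_filter_add_card_filter_not]

/-- **The loop step of `(H⁺_{q,u})`**: for a loop `ℓ`, `(H⁺_{q,u})` on `M ＼ {ℓ}` gives `(H⁺_{q,u})` on `M`. -/
theorem hallIneq_of_delete_isLoop {ℓ : α} (hℓ : M.IsLoop ℓ) {q u : ℕ}
    (h : Profile.HallIneq (M ＼ ({ℓ} : Set α)) q u) : Profile.HallIneq M q u := by
  intro 𝒜 h𝒜
  set 𝒜₀ := 𝒜.filter (fun B => ℓ ∉ B) with h𝒜₀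
  set 𝒜₁ := (𝒜.filter (fun B => ℓ ∈ B)).image (fun B => B.erase ℓ) with h𝒜₁
  have h𝒜₀R : 𝒜₀ ⊆ Profile.Rq (M ＼ ({ℓ} : Set α)) q := by
    intro B hB
    rw [h𝒜₀, Finset.mem_filter] at hB
    exact mem_Rq_delete_of_isLoop_notMem (h𝒜 hB.1) hB.2
  have h𝒜₁R : 𝒜₁ ⊆ Profile.Rq (M ＼ ({ℓ} : Set α)) q := by
    intro B' hB'
    rw [h𝒜₁, Finset.mem_image] at hB'
    obtain ⟨B, hB, rfl⟩ := hB'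
    rw [Finset.mem_filter] at hB
    exact erase_mem_Rq_delete_of_isLoop_mem hℓ (h𝒜 hB.1) hB.2
  -- the prices: split 𝒜 by ℓ ∈ B
  have hsum : ∑ B ∈ 𝒜, Profile.price M q u B =
      ∑ B ∈ 𝒜₀, Profile.price (M ＼ ({ℓ} : Set α)) q u B + ∑ B' ∈ 𝒜₁, Profile.price (M ＼ ({ℓ} : Set α)) q u B' := by
    rw [← Finset.sum_filter_add_sum_filter_not 𝒜 (fun B => ℓ ∈ B), add_comm]
    congr 1
    · apply Finset.sum_congr rfl
      intro B hB
      exact price_delete_of_isLoop_notMem hℓ q u (Finset.mem_filter.1 hB).2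
    · rw [h𝒜₁, Finset.sum_image (erase_injOn_filter_mem 𝒜 ℓ)]
      apply Finset.sum_congr rfl
      intro B hB
      exact price_delete_of_isLoop_mem q u (Finset.mem_filter.1 hB).2
  have h0 := h 𝒜₀ h𝒜₀R
  have h1 := h 𝒜₁ h𝒜₁R
  have hs : ((Shadow.shadowLevel (M ＼ ({ℓ} : Set α)) u 𝒜₀).card : ℚ) +
      ((Shadow.shadowLevel (M ＼ ({ℓ} : Set α)) u 𝒜₁).card : ℚ) ≤ ((Shadow.shadowLevel M u 𝒜).card : ℚ) := by
    exact_mod_cast card_shadowLevel_ge_of_isLoop hℓ u 𝒜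
  rw [hsum]
  linarith

end HallLoop

end PercRepro
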